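import Summits.NavierStokesRegularity.NavierStokesRegularity.Theses.AxisymmetricExtremality
import Literature.Analysis.FluidPDE.SqIntegralBalance
import HarnessLib

/-!
# Seregin 2020, Lemma 2.2 (after Nazarov–Uraltseva 2012): Tonelli on the cylinders
# `Q = I × B_R(x₀)` for the level sets of a function of the class 𝒱

Helper toward the stub `stub_seregin2020TypeII` of the crux `AxisymmetricKatoGlobal` (= the named
fact `Literature.Analysis.FluidPDE.Seregin2020_axisymmetricSingularPoint_typeII`, G. Seregin,
Anal. Math. Phys. 10 (2020) Paper 46 = arXiv:2006.04140, Thm 2.1), reduced in the tree to the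
written-out hypothesis `hWH′` (corrected Lemma 2.2 = Nazarov–Uraltseva, St. Petersburg Math.
J. 23 (2012) 93–115 = arXiv:1011.1888, Lemma 4.2 for the class 𝒱), see
`blowupIndex_eq_top_of_weakHarnack'`. The De Giorgi-type measure lemmata of N–U §3 (Lemma 3.2
propagation in measure, Lemma 3.3 shrinking levels) pass between space–time measures of level
sets `|Q ∩ {Φ ∈ T}|`, `∫∫_{Q ∩ {Φ ∈ T}} |∇Φ|`, and the time integrals of their slices, for
functions `Φ` which (class 𝒱) are only a.e.-defined on `Q` but have slices that are `C¹` off the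
symmetry axis. This file supplies that bookkeeping:

* `aemeasurable_restrict_ball_of_contDiffOn_offAxis` — a slice `C¹` off the axis is
  a.e.-measurable on the ball (the axis is null);
* `lintegral_inter_levelSet_eq_lintegral_slices` — `∫∫_{Q ∩ {Φ ∈ T}} G = ∫_I ∫_{B ∩ {Φ(t,·) ∈ T}} G(t,·)`;
* `volume_inter_levelSet_eq_lintegral_slices` — `|Q ∩ {Φ ∈ T}| = ∫_I |B ∩ {Φ(t,·) ∈ T}| dt`.

## References

* A. I. Nazarov, N. N. Uraltseva, St. Petersburg Math. J. 23 (2012) 93–115 = arXiv:1011.1888,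
  §3, proofs of Lemmata 3.2–3.3 (integration of slice estimates in `t`). [NazarovUraltseva2012]
* G. Seregin, Anal. Math. Phys. 10 (2020), Paper 46 = arXiv:2006.04140, Lemma 2.2, the class 𝒱.
  [Seregin2020]
-/

-- the problem directory repeats the summit name (D-0017); core's `dupNamespace` linter fires
set_option linter.dupNamespace false

noncomputable section

open MeasureTheory Set Function Filter Topology Metric Module
open scoped NNReal ENNReal

namespace Summit.NavierStokesRegularity.NavierStokesRegularity.Theorems.AxisymmetricKatoGlobal.EulerScaling

open Literature.Analysis.FluidPDE

/-! ### Slices of functions that are `C¹` off the axis -/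

/-- A function on a ball of `ℝ³` which is `C¹` off the symmetry axis is a.e.-measurable on the
ball (the axis is Lebesgue-null, `volume_setOf_cylRadius_eq_zero`). [folklore] -/
theorem aemeasurable_restrict_ball_of_contDiffOn_offAxis {w : EuclideanSpace ℝ (Fin 3) → ℝ}
    {x₀ : EuclideanSpace ℝ (Fin 3)} {R : ℝ}
    (hw : ContDiffOn ℝ 1 w (ball x₀ R ∩ {x | cylRadius x ≠ 0})) :
    AEMeasurable w (volume.restrict (ball x₀ R)) := by
  have hS : MeasurableSet (ball x₀ R ∩ {x : EuclideanSpace ℝ (Fin 3) | cylRadius x ≠ 0}) :=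
    measurableSet_ball.inter
      (isOpen_ne_fun continuous_cylRadius continuous_const).measurableSet
  have hae : (ball x₀ R ∩ {x : EuclideanSpace ℝ (Fin 3) | cylRadius x ≠ 0} : Set _) =ᵐ[volume]
      (ball x₀ R : Set (EuclideanSpace ℝ (Fin 3))) := by
    refine ae_eq_set.2 ⟨?_, ?_⟩
    · rw [eq_empty_of_subset_empty (s := (ball x₀ R ∩ {x | cylRadius x ≠ 0}) \ ball x₀ R)
        (fun x hx => (hx.2 hx.1.1).elim), measure_empty]
    · refine measure_mono_null (fun x hx => ?_) volume_setOf_cylRadius_eq_zero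
      by_contra h
      exact hx.2 ⟨hx.1, h⟩
  rw [← Measure.restrict_congr_set hae]
  exact hw.continuousOn.aemeasurable hS

/-! ### Tonelli on the cylinder `Q = I × B` for level sets of `Φ` -/

/-- **Tonelli for a weighted level set of `Φ` in the cylinder `Q = I × B_R(x₀)`**: for
`Φ` a.e.-measurable on `Q` with a.e.-measurable slices on `B` (for a.e. `t ∈ I`), `G ≥ 0`
a.e.-measurable on `Q`,
and a Borel set of levels `T`,
`∫∫_{Q ∩ {Φ ∈ T}} G = ∫_{t ∈ I} ∫_{B ∩ {Φ(t,·) ∈ T}} G(t, ·)`. [folklore] -/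
theorem lintegral_inter_levelSet_eq_lintegral_slices
    {Φ : ℝ → EuclideanSpace ℝ (Fin 3) → ℝ} {x₀ : EuclideanSpace ℝ (Fin 3)} {R : ℝ} {I : Set ℝ}
    (hΦm : AEMeasurable (uncurry Φ) (volume.restrict (I ×ˢ ball x₀ R)))
    (hsl : ∀ᵐ t ∂(volume.restrict I), AEMeasurable (Φ t) (volume.restrict (ball x₀ R)))
    {T : Set ℝ} (hT : MeasurableSet T)
    {G : ℝ × EuclideanSpace ℝ (Fin 3) → ℝ≥0∞}
    (hG : AEMeasurable G (volume.restrict (I ×ˢ ball x₀ R))) :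
    ∫⁻ z in (I ×ˢ ball x₀ R) ∩ {z | Φ z.1 z.2 ∈ T}, G z =
      ∫⁻ t in I, ∫⁻ x in ball x₀ R ∩ {x | Φ t x ∈ T}, G (t, x) := by
  set B : Set (EuclideanSpace ℝ (Fin 3)) := ball x₀ R with hB
  set Q : Set (ℝ × EuclideanSpace ℝ (Fin 3)) := I ×ˢ B with hQ
  have hprod : (volume.restrict Q : Measure (ℝ × EuclideanSpace ℝ (Fin 3))) =
      (volume.restrict I).prod (volume.restrict B) := by
    rw [hQ, Measure.volume_eq_prod, Measure.prod_restrict]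
  -- the level set is null-measurable for `volume|Q`
  have hpre : NullMeasurableSet {z : ℝ × EuclideanSpace ℝ (Fin 3) | Φ z.1 z.2 ∈ T}
      (volume.restrict Q) := hΦm.nullMeasurable hT
  -- rewrite the set integral as an integral of an indicator against `volume|Q`
  have h1 : ∫⁻ z in Q ∩ {z | Φ z.1 z.2 ∈ T}, G z =
      ∫⁻ z, {z : ℝ × EuclideanSpace ℝ (Fin 3) | Φ z.1 z.2 ∈ T}.indicator G z
        ∂(volume.restrict Q) := by
    rw [lintegral_indicator₀ hpre, Measure.restrict_restrict₀ hpre, inter_comm]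
  -- the indicator as a product with `1_T ∘ Φ`
  have h2 : ∀ z : ℝ × EuclideanSpace ℝ (Fin 3),
      {z : ℝ × EuclideanSpace ℝ (Fin 3) | Φ z.1 z.2 ∈ T}.indicator G z =
        T.indicator (fun _ => (1 : ℝ≥0∞)) (Φ z.1 z.2) * G z := by
    intro z
    by_cases hz : Φ z.1 z.2 ∈ T
    · rw [indicator_of_mem (show z ∈ {z : ℝ × EuclideanSpace ℝ (Fin 3) | Φ z.1 z.2 ∈ T} from hz),
        indicator_of_mem hz, one_mul]
    · rw [indicator_of_notMem
        (show z ∉ {z : ℝ × EuclideanSpace ℝ (Fin 3) | Φ z.1 z.2 ∈ T} from hz),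
        indicator_of_notMem hz, zero_mul]
  have hind : Measurable (T.indicator fun _ : ℝ => (1 : ℝ≥0∞)) :=
    measurable_const.indicator hT
  have hFm : AEMeasurable (fun z : ℝ × EuclideanSpace ℝ (Fin 3) =>
      T.indicator (fun _ => (1 : ℝ≥0∞)) (Φ z.1 z.2) * G z) ((volume.restrict I).prod
        (volume.restrict B)) := by
    rw [← hprod]
    exact (hind.comp_aemeasurable hΦm).mul hG
  rw [h1]
  simp_rw [h2]
  rw [hprod, lintegral_prod _ hFm]
  refine lintegral_congr_ae ?_
  filter_upwards [hsl] with t hslt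
  -- the slice at a.e. time `t ∈ I`
  have hpre_t : NullMeasurableSet {x : EuclideanSpace ℝ (Fin 3) | Φ t x ∈ T}
      (volume.restrict B) := hslt.nullMeasurable hT
  have h3 : ∀ x : EuclideanSpace ℝ (Fin 3),
      T.indicator (fun _ => (1 : ℝ≥0∞)) (Φ t x) * G (t, x) =
        {x : EuclideanSpace ℝ (Fin 3) | Φ t x ∈ T}.indicator (fun x => G (t, x)) x := by
    intro x
    by_cases hx : Φ t x ∈ T
    · rw [indicator_of_mem hx, indicator_of_mem
        (show x ∈ {x : EuclideanSpace ℝ (Fin 3) | Φ t x ∈ T} from hx), one_mul]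
    · rw [indicator_of_notMem hx, indicator_of_notMem
        (show x ∉ {x : EuclideanSpace ℝ (Fin 3) | Φ t x ∈ T} from hx), zero_mul]
  simp_rw [h3]
  rw [lintegral_indicator₀ hpre_t, Measure.restrict_restrict₀ hpre_t, inter_comm]

/-- **Tonelli for a level set of `Φ` in the cylinder `Q = I × B_R(x₀)`**:
`|Q ∩ {Φ ∈ T}| = ∫_{t ∈ I} |B ∩ {Φ(t, ·) ∈ T}| dt`. [folklore] -/
theorem volume_inter_levelSet_eq_lintegral_slices
    {Φ : ℝ → EuclideanSpace ℝ (Fin 3) → ℝ} {x₀ : EuclideanSpace ℝ (Fin 3)} {R : ℝ} {I : Set ℝ}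
    (hΦm : AEMeasurable (uncurry Φ) (volume.restrict (I ×ˢ ball x₀ R)))
    (hsl : ∀ᵐ t ∂(volume.restrict I), AEMeasurable (Φ t) (volume.restrict (ball x₀ R)))
    {T : Set ℝ} (hT : MeasurableSet T) :
    volume ((I ×ˢ ball x₀ R) ∩ {z | Φ z.1 z.2 ∈ T}) =
      ∫⁻ t in I, volume (ball x₀ R ∩ {x | Φ t x ∈ T}) := by
  have h := lintegral_inter_levelSet_eq_lintegral_slices hΦm hsl hT
    (G := fun _ => (1 : ℝ≥0∞)) aemeasurable_const
  simp only [setLIntegral_one] at h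
  exact h

end Summit.NavierStokesRegularity.NavierStokesRegularity.Theorems.AxisymmetricKatoGlobal.EulerScaling

end
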